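import Summits.QuantumFields.YangMills.Theorems.AtomicSynthesisMomentWeights

/-!
# AtomicSynthesis (stmt-QuantumFields-28126), stub `stub_singleSlot` — H1: moment-killing combinations of translates

AUTHOR: planner ym-idea-11 g14 (HOME `g14/momentWeights.lean`, second half, sorry-free); landed by prover w4 g22 (`--supports 28126`;
also path α of 23138 / 22956).  For a compactly supported Schwartz bump `b` on `ℝ⁴` with `∫ b ≠ 0` and every order `N`, grid
translates of `b` combine to a bump with the same integral and vanishing moments of orders `1 … N−1` (`momentKilling :
MomentKilling b N`): the weights come from `exists_weights_of_moments` (`AtomicSynthesisMomentWeights`), the moments of translates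
from translation invariance of volume and the binomial expansion (`integral_translate_monomial`).
Elementary; no stub/crux/rung/summit is closed by this file; the YM mass gap is NOT proved. [folklore]
-/

set_option autoImplicit false

open scoped BigOperators
open Finset Matrix

namespace Summit.QuantumFields.YangMills.Cruxes.AtomicSynthesis.SingleSlotPlan

variable {d N : ℕ}

/-! ## The measure-theoretic half: H1 `MomentKilling b N` for a compactly supported Schwartz bump with `∫ b ≠ 0` -/

section Measure

open MeasureTheory

/-- `ℝ⁴`. -/
abbrev E4 := EuclideanSpace ℝ (Fin 4)

/-- H1 target (verbatim the plan's `MomentKilling`): a finite combination of translates of `b` with the same integral and vanishing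
moments of orders `1 … N−1`. -/
def MomentKilling (b : SchwartzMap E4 ℝ) (N : ℕ) : Prop :=
  ∃ (J : ℕ) (lam : Fin J → ℝ) (u : Fin J → E4),
    (∫ y, (∑ j, lam j * b (y - u j)) = ∫ y, b y) ∧
    ∀ α : Fin 4 → ℕ, 1 ≤ ∑ i, α i → ∑ i, α i < N →
      ∫ y, (∑ j, lam j * b (y - u j)) * ∏ i, (y i) ^ (α i) = 0

/-- The grid point `u ∈ {0,…,N−1}⁴ ⊂ ℝ⁴`. -/
noncomputable def pt {N : ℕ} (u : Box 4 N) : E4 := WithLp.toLp 2 (fun i => ((u i : ℕ) : ℝ))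

/-- Coordinates of the grid point `pt u`. -/
@[simp] theorem pt_apply {N : ℕ} (u : Box 4 N) (i : Fin 4) : pt u i = ((u i : ℕ) : ℝ) := by
  simp [pt]

/-- The moment table of `b`: `M δ = ∫ b(w) w^δ dw`. -/
noncomputable def bMoment (b : SchwartzMap E4 ℝ) (δ : Fin 4 → ℕ) : ℝ := ∫ w, b w * ∏ i, (w i) ^ (δ i)

/-- The zeroth moment is the integral. -/
theorem bMoment_zero (b : SchwartzMap E4 ℝ) : bMoment b 0 = ∫ w, b w := by
  simp [bMoment]

/-- A translate of `b` times a continuous function is continuous. -/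
theorem continuous_translate_mul (b : SchwartzMap E4 ℝ) (p : E4) (g : E4 → ℝ) (hg : Continuous g) :
    Continuous fun y : E4 => b (y - p) * g y :=
  (b.continuous.comp (continuous_id.sub continuous_const)).mul hg

/-- A translate of a compactly supported `b` times any function is compactly supported. -/
theorem hasCompactSupport_translate_mul (b : SchwartzMap E4 ℝ) (hb : HasCompactSupport (b : E4 → ℝ)) (p : E4)
    (g : E4 → ℝ) : HasCompactSupport fun y : E4 => b (y - p) * g y :=
  (hb.comp_homeomorph (Homeomorph.subRight p)).mul_right

/-- Monomials are continuous on `ℝ⁴`. -/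
theorem continuous_monomial (δ : Fin 4 → ℕ) : Continuous fun y : E4 => ∏ i, (y i) ^ (δ i) := by
  fun_prop

/-- A translate of a compactly supported `b` times a continuous function is integrable. -/
theorem integrable_translate_mul (b : SchwartzMap E4 ℝ) (hb : HasCompactSupport (b : E4 → ℝ)) (p : E4)
    (g : E4 → ℝ) (hg : Continuous g) : Integrable fun y : E4 => b (y - p) * g y :=
  (continuous_translate_mul b p g hg).integrable_of_hasCompactSupport (hasCompactSupport_translate_mul b hb p g)

/-- Moments of a translate, computed: `∫ b(y − u) y^α dy = momentOfTranslate 4 N (bMoment b) α u`. [folklore] -/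
theorem integral_translate_monomial (b : SchwartzMap E4 ℝ) (hb : HasCompactSupport (b : E4 → ℝ)) {N : ℕ}
    (α u : Box 4 N) :
    ∫ y, b (y - pt u) * ∏ i, (y i) ^ (α i : ℕ) = momentOfTranslate 4 N (bMoment b) α u := by
  classical
  rw [momentOfTranslate_eq_binomial]
  -- translate: `y = w + pt u`
  set f : E4 → ℝ := fun w => b w * ∏ i, (w i + ((u i : ℕ) : ℝ)) ^ (α i : ℕ) with hf
  have h1 : (fun y : E4 => b (y - pt u) * ∏ i, (y i) ^ (α i : ℕ)) = fun y => f (y - pt u) := by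
    funext y
    simp [hf]
  rw [h1, integral_sub_right_eq_self f (pt u)]
  -- expand binomially
  have h2 : ∀ w : E4, (∏ i, (w i + ((u i : ℕ) : ℝ)) ^ (α i : ℕ)) =
      ∑ κ ∈ Fintype.piFinset (fun i => Finset.range ((α i : ℕ) + 1)),
        ∏ i, ((w i) ^ (κ i) * ((u i : ℕ) : ℝ) ^ ((α i : ℕ) - κ i) * (((α i : ℕ).choose (κ i) : ℕ) : ℝ)) := by
    intro w
    simp_rw [add_pow]
    rw [Finset.prod_univ_sum]
  simp_rw [hf, h2, Finset.mul_sum]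
  rw [integral_finsetSum]
  · refine Finset.sum_congr rfl fun κ _ => ?_
    rw [bMoment, ← integral_const_mul]
    refine integral_congr_ae (Filter.Eventually.of_forall fun w => ?_)
    simp only
    rw [Finset.prod_mul_distrib, Finset.prod_mul_distrib, Finset.prod_mul_distrib]
    ring
  · intro κ _
    have hc : Continuous fun w : E4 =>
        ∏ i, ((w i) ^ (κ i) * ((u i : ℕ) : ℝ) ^ ((α i : ℕ) - κ i) * (((α i : ℕ).choose (κ i) : ℕ) : ℝ)) := by
      fun_prop
    have := integrable_translate_mul b hb 0 _ hc
    simpa using this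

/-- Key computation: the box moments of the grid combination. -/
theorem momentKilling_key (b : SchwartzMap E4 ℝ) (hb : HasCompactSupport (b : E4 → ℝ)) {N : ℕ}
    (lam : Box 4 N → ℝ) (e : Box 4 N ≃ Fin (Fintype.card (Box 4 N))) (δ : Fin 4 → ℕ) (hδ : ∀ i, δ i < N) :
    ∫ y, (∑ j, lam (e.symm j) * b (y - pt (e.symm j))) * ∏ i, (y i) ^ (δ i) =
      ∑ u, lam u * momentOfTranslate 4 N (bMoment b) (fun i => ⟨δ i, hδ i⟩) u := by
  classical
  have hP : Continuous fun y : E4 => ∏ i, (y i) ^ (δ i) := continuous_monomial δ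
  simp_rw [Finset.sum_mul, mul_assoc]
  rw [integral_finsetSum]
  · simp_rw [integral_const_mul]
    rw [e.symm.sum_comp (fun u => lam u * ∫ y, b (y - pt u) * ∏ i, (y i) ^ (δ i))]
    refine Finset.sum_congr rfl fun u _ => ?_
    rw [← integral_translate_monomial b hb (fun i => ⟨δ i, hδ i⟩) u]
  · intro j _
    exact (integrable_translate_mul b hb _ _ hP).const_mul _

/-- **H1 (measure half + algebra): moment-killing combinations of translates exist for every order.** [folklore] -/
theorem momentKilling (b : SchwartzMap E4 ℝ) (hb : HasCompactSupport (b : E4 → ℝ)) (hI : (∫ y, b y) ≠ 0)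
    (N : ℕ) : MomentKilling b N := by
  classical
  rcases Nat.eq_zero_or_pos N with hN | hN
  · -- `N = 0`: no moment conditions; one translate by `0` with weight `1`
    refine ⟨1, fun _ => 1, fun _ => 0, ?_, ?_⟩
    · simp
    · intro α _ hlt; omega
  -- `N ≥ 1`: solve the square moment system on the grid
  let α0 : Box 4 N := fun _ => ⟨0, hN⟩
  let t : Box 4 N → ℝ := fun α => if α = α0 then ∫ y, b y else 0
  have hM : bMoment b 0 ≠ 0 := by rwa [bMoment_zero]
  obtain ⟨lam, hlam⟩ := exists_weights_of_moments 4 N (bMoment b) hM t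
  let e := Fintype.equivFin (Box 4 N)
  refine ⟨Fintype.card (Box 4 N), fun j => lam (e.symm j), fun j => pt (e.symm j), ?_, ?_⟩
  -- order `0`: the combination has the integral of `b`
  · have key := momentKilling_key b hb lam e (fun _ => 0) (fun _ => hN)
    simp only [pow_zero, Finset.prod_const_one, mul_one] at key
    rw [key, hlam]
    exact if_pos rfl
  -- orders `1 … N−1`: the moments vanish
  · intro α h1 h2
    have hδ : ∀ i, α i < N := fun i =>
      lt_of_le_of_lt (Finset.single_le_sum (fun j _ => Nat.zero_le (α j)) (Finset.mem_univ i)) h2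
    rw [momentKilling_key b hb lam e α hδ, hlam]
    apply if_neg
    intro heq
    have h0 : ∀ i, α i = 0 := fun i => by
      have := congrArg (fun f : Box 4 N => ((f i : Fin N) : ℕ)) heq
      simpa [α0] using this
    simp [h0] at h1

end Measure

end Summit.QuantumFields.YangMills.Cruxes.AtomicSynthesis.SingleSlotPlan
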